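import Literature.Computability.MetaComplexity.CMMSA
import HarnessLib

/-!
# Padding CMMSA instances with dummy variables (constant degree bound to `Δ(n) = (log n)^{1/2}`)

Topic `Computability/Complexity`. Hirahara's interface for the NP-hardness of `MCSP*` is the promise
problem `gapCMMSA g ε sqrtLog` (`CMMSA.lean`; Hirahara 2022, Def. 5.1 and Thm. 5.2 at
`Δ(n) = (log n)^{1/2}`): the degree of the collection may grow like `(log n)^{1/2}` in the number `n`
of variables. A CONSTANT degree bound `K` is met by this parameter once `n ≥ 2^{K²}`; adding
`2^{K²}` variables of weight `0` occurring in no formula changes neither the satisfying assignments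
nor their weights, so it maps yes/no-instances of `gapCMMSA g ε K` to yes/no-instances of
`gapCMMSA g ε sqrtLog`.

* `CMMSAPad.padInstance P I` — `I` with `P` extra dummy variables; `wellFormed_pad`, `degree_pad`,
  `weightOf_pad`;
* `CMMSAPad.pad_mem_yesSet`, `CMMSAPad.pad_mem_noSet` — the transport for `P = 2^{K²}`
  (`le_sqrtLog_add`: `K ≤ sqrtLog (n + 2^{K²})`).

The (trivial) polynomial-time implementation and the Karp reduction are with the assembly in
`MCSPStarFromPCPTheorem.lean`.

## References

* S. Hirahara, *NP-hardness of learning programs and partial MCSP*, ECCC TR22-119 (FOCS 2022),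
  Def. 5.1 ("The size of an instance of CMMSA is measured by the number n of input variables") and
  Thm. 5.2 (degree `Δ(n)`), p. 16 ("We will use this result for Δ(n) := (log n)^{1/2}")
  [Hirahara2022PartialMCSP].
-/

namespace Literature.Computability.Complexity

open MetaComplexity

namespace CMMSAPad

/-! ### Padding with dummy variables -/

/-- The instance with `P` extra variables of weight `0` occurring in no formula (its size measure `n`
grows, nothing else changes). [cite: Hirahara2022PartialMCSP, Def. 5.1 (size measure n) and Thm. 5.2 (degree Δ(n))] -/
def padInstance (P : ℕ) (I : CMMSAInstance) : CMMSAInstance :=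
  ⟨I.numVars + P, I.formulas, I.weight ++ List.replicate P 0, I.threshold⟩

/-- Padding preserves well-formedness. [folklore] -/
theorem wellFormed_pad (P : ℕ) {I : CMMSAInstance} (h : I.WellFormed) : (padInstance P I).WellFormed :=
  ⟨by simp [padInstance, h.1], fun φ hφ t ht i hi => Nat.lt_add_right P (h.2 φ hφ t ht i hi)⟩

/-- Padding does not change the degree. [folklore] -/
@[simp] theorem degree_pad (P : ℕ) (I : CMMSAInstance) : (padInstance P I).degree = I.degree := rfl

/-- Padding does not change the weight of any assignment (well-formed input). [folklore] -/
theorem weightOf_pad (P : ℕ) {I : CMMSAInstance} (h : I.weight.length = I.numVars) (a : ℕ → Bool) :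
    (padInstance P I).weightOf a = I.weightOf a := by
  unfold CMMSAInstance.weightOf
  rw [show (padInstance P I).numVars = I.numVars + P from rfl, Finset.sum_range_add]
  have h1 : ∀ i ∈ Finset.range I.numVars, (if a i = true then (padInstance P I).w i else 0) =
      if a i = true then I.w i else 0 := by
    intro i hi
    have hw : (padInstance P I).w i = I.w i := by
      unfold CMMSAInstance.w padInstance
      simp only
      rw [List.getD_append _ _ _ _ (by rw [h]; exact Finset.mem_range.1 hi)]
    rw [hw]
  have h2 : ∀ i ∈ Finset.range P, (if a (I.numVars + i) = true then (padInstance P I).w (I.numVars + i) else 0) = 0 := by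
    intro i hi
    have hw : (padInstance P I).w (I.numVars + i) = 0 := by
      unfold CMMSAInstance.w padInstance
      simp only
      rw [List.getD_append_right _ _ _ _ (by rw [h]; omega), h, Nat.add_sub_cancel_left]
      simp
    rw [hw]; simp
  rw [Finset.sum_congr rfl h1, Finset.sum_congr rfl h2, Finset.sum_const_zero, add_zero]

/-- `sqrtLog (n + 2^{K²}) ≥ K`. [cite: Hirahara2022PartialMCSP, p. 16 (Δ(n) = (log n)^{1/2})] -/
theorem le_sqrtLog_add (K n : ℕ) : K ≤ sqrtLog (n + 2 ^ (K ^ 2)) := by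
  calc K = sqrtLog (2 ^ (K ^ 2)) := (sqrtLog_two_pow_sq K).symm
    _ ≤ sqrtLog (n + 2 ^ (K ^ 2)) := sqrtLog_mono (Nat.le_add_left _ _)

/-- **Yes-instances of degree `≤ K` pad to yes-instances for the degree bound `sqrtLog`.** [cite: Hirahara2022PartialMCSP, Def. 5.1 and Thm. 5.2] -/
theorem pad_mem_yesSet {K : ℕ} {I : CMMSAInstance} (hI : I ∈ CMMSA.yesSet fun _ => K) :
    padInstance (2 ^ (K ^ 2)) I ∈ CMMSA.yesSet sqrtLog := by
  obtain ⟨hwf, hdeg, a, ha, hall⟩ := hI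
  refine ⟨wellFormed_pad _ hwf, ?_, a, ?_, hall⟩
  · rw [degree_pad]; exact hdeg.trans (le_sqrtLog_add K I.numVars)
  · rw [weightOf_pad _ hwf.1]; exact ha

/-- **No-instances (constant gap and soundness, degree `≤ K`) pad to no-instances for `sqrtLog`.** [cite: Hirahara2022PartialMCSP, Def. 5.1 and Thm. 5.2] -/
theorem pad_mem_noSet {K : ℕ} {g ε : ℝ} {I : CMMSAInstance}
    (hI : I ∈ CMMSA.noSet (fun _ => g) (fun _ => ε) fun _ => K) :
    padInstance (2 ^ (K ^ 2)) I ∈ CMMSA.noSet (fun _ => g) (fun _ => ε) sqrtLog := by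
  obtain ⟨hwf, hdeg, hno⟩ := hI
  refine ⟨wellFormed_pad _ hwf, ?_, fun a ha => ?_⟩
  · rw [degree_pad]; exact hdeg.trans (le_sqrtLog_add K I.numVars)
  · rw [weightOf_pad _ hwf.1] at ha
    exact hno a ha

end CMMSAPad

end Literature.Computability.Complexity
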